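import Summits.QuantumFields.YangMills.Theorems.LangevinControlUVOSLegsFromFemtoAndGapStubCollar
import Summits.QuantumFields.YangMills.Theorems.LangevinControlUVOSLegsFromFemtoAndGapStubLowerAux
import Summits.QuantumFields.YangMills.Theorems.LangevinControlUVOSLegsFromFemtoAndGapStubLowerMoments
import Summits.QuantumFields.YangMills.Theorems.LangevinControlUVOSLegsFromFemtoAndGapStubLowerBump

/-!
# Stub `stub_lower` of line `dlr-collar-transfer` (crux `OSLegsFromFemtoAndGap`, stmt-QuantumFields-9367):
# cubes, the one-cube DLR step for the line's kernels, and the per-pair covariance floor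

In the vocabulary of the route Defs file (`cubeSites`, `cubeEdges`, `depth`, `dens`, `kerE`, `kerCov`,
`torusE`); `fst_mem_cubeSites_of_mem_cubeEdges`, `continuous_dens` are the sibling stub's
(`…StubCollar.lean`):

* geometry of the cube of "radius" `R` around a site `x` (corner `x - R`, side `2R+1`): window of its
  links, depth of nearby sites;
* `torusE_eq_torusE_kerE`: the torus DLR step through that cube for a bounded continuous cylinder
  observable read inside the cube (tree `wilsonExpectation_toTorusObservable_eq`, window form);
* `cov_pair_lower`: law of total covariance through the cube — a conditional covariance floor valid
  for every exterior and a boundary law for the two one-point kernels give a floor on the torus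
  covariance of `dens x`, `dens y`;
* `k3_triple_lower`: the same for the third cumulant `torusK3` (law of total cumulance).
-/

set_option autoImplicit false

noncomputable section

open scoped SchwartzMap
open MeasureTheory Filter Topology
open Literature.MathematicalPhysics.QuantumFieldTheory Literature.MathematicalPhysics.QuantumLattice
open Literature.MathematicalPhysics.AQFT Literature.Probability.LatticeModels
open Summit.QuantumFields.YangMills.Theorems.OSLegsFromFemtoAndGap.StubLower

namespace Summit.QuantumFields.YangMills.Cruxes.OSLegsFromFemtoAndGap.DlrCollarTransfer.StubLower

/-! ### Cubes around a site -/

section Cube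

/-- Membership in `cubeSites`. [folklore] -/
theorem mem_cubeSites_iff (c : Fin 4 → ℤ) (b : ℕ) (z : Fin 4 → ℤ) :
    z ∈ cubeSites c b ↔ ∀ j, c j ≤ z j ∧ z j < c j + b := by
  simp [cubeSites, Fintype.mem_piFinset, Finset.mem_Ico]

/-- Window of the links of the cube of radius `R` around `x` (corner `x - R`, side `2R+1`). [folklore] -/
theorem cubeEdges_window (x : Fin 4 → ℤ) (R : ℕ)
    (e : Literature.MathematicalPhysics.QuantumLattice.ZdEdge 4)
    (he : e ∈ cubeEdges (fun j => x j - R) (2 * R + 1)) (j : Fin 4) :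
    x j - R ≤ e.1 j ∧ e.1 j ≤ x j + R := by
  have h := (mem_cubeSites_iff _ _ _).1 (fst_mem_cubeSites_of_mem_cubeEdges he) j
  push_cast at h
  constructor <;> linarith [h.1, h.2]

/-- Depth in the cube of radius `R` around `x` of a site at coordinate distance `≤ t` from `x`:
at least `R + 1 - t`. [folklore] -/
theorem le_depth_cube (x z : Fin 4 → ℤ) (R : ℕ) {t : ℝ} (hz : ∀ j, |((z j : ℤ) : ℝ) - x j| ≤ t) :
    (R : ℝ) + 1 - t ≤ (depth (fun j => x j - R) (2 * R + 1) z : ℝ) := by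
  obtain ⟨j₀, -, hj₀⟩ := Finset.exists_mem_eq_inf' Finset.univ_nonempty
    (fun j : Fin 4 => min (z j - (x j - R) + 1).toNat ((x j - R) + (2 * R + 1 : ℕ) - z j).toNat)
  unfold depth
  rw [hj₀, Nat.cast_min]
  have ht := hz j₀
  rw [abs_le] at ht
  have cast : ∀ k : ℤ, (k : ℝ) ≤ ((k.toNat : ℕ) : ℝ) := fun k => by
    have := Int.self_le_toNat k
    exact_mod_cast this
  refine le_min ?_ ?_
  · refine le_trans ?_ (cast _)
    push_cast; linarith
  · refine le_trans ?_ (cast _)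
    push_cast; linarith

/-- Products of cylinder observables are cylinder observables. [folklore] -/
theorem isCylinder_mul {G : Type} {F F' : LGConfig 4 G → ℝ}
    {S S' : Finset (Literature.MathematicalPhysics.QuantumLattice.ZdEdge 4)}
    (hF : IsCylinder F S) (hF' : IsCylinder F' S') : IsCylinder (fun U => F U * F' U) (S ∪ S') := by
  classical
  intro U V h
  show F U * F' U = F V * F' V
  rw [hF fun e he => h e (by simp [Finset.mem_coe.1 he]),
    hF' fun e he => h e (by simp [Finset.mem_coe.1 he])]

end Cube

/-! ### The one-cube DLR step for the line's kernels -/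

section DLRStep

variable (G : Type) [Group G] [TopologicalSpace G] [IsTopologicalGroup G] [CompactSpace G]
  [MeasurableSpace G] [BorelSpace G] (r : LatticeRep G)

/-- **One-cube DLR step.** For a bounded continuous cylinder observable `F` whose support sits in
the window `x + [-R, R]⁴` and a torus of half-side `L ≥ R + 1`, the torus expectation of `F` equals
that of its cube-kernel average `η ↦ kerE (F)` (cube of radius `R` around `x`). [folklore] -/
theorem torusE_eq_torusE_kerE (β : ℝ) (x : Fin 4 → ℤ) (R L : ℕ) (hRL : R + 1 ≤ L)
    {F : LGConfig 4 G → ℝ} (hF : Continuous F) {C : ℝ} (hC : ∀ U, |F U| ≤ C)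
    {S₀ : Finset (Literature.MathematicalPhysics.QuantumLattice.ZdEdge 4)} (hFS : IsCylinder F S₀)
    (hS₀ : ∀ e ∈ S₀, ∀ j, x j - R ≤ e.1 j ∧ e.1 j ≤ x j + R) :
    torusE G r β L F = torusE G r β L fun η => kerE G r β (fun j => x j - R) (2 * R + 1) η F := by
  haveI := r.secondCountableTopology
  unfold torusE kerE
  refine integral_torusLift_eq_integral_kernel r.ρ r.continuous β _ hF hC hFS (2 * L + 1)
    (fun j => x j - R - 1) fun e he j => ?_
  rcases Finset.mem_union.1 he with h1 | h2
  · have := cubeEdges_window x R e h1 j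
    push_cast
    constructor <;> linarith [this.1, this.2, (by exact_mod_cast hRL : (R : ℤ) + 1 ≤ L)]
  · have := hS₀ e h2 j
    push_cast
    constructor <;> linarith [this.1, this.2, (by exact_mod_cast hRL : (R : ℤ) + 1 ≤ L)]

/-- The support of `dens z` for a site `z` with `|z - x|_∞ + 1 ≤ R` sits in the window of the cube. [folklore] -/
theorem dens_supp_window (x z : Fin 4 → ℤ) (R : ℕ) (hz : ∀ j, |z j - x j| + 1 ≤ R)
    (e : Literature.MathematicalPhysics.QuantumLattice.ZdEdge 4)
    (he : e ∈ r.curvature.supp.image fun e => (e.1 + z, e.2)) (j : Fin 4) :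
    x j - R ≤ e.1 j ∧ e.1 j ≤ x j + R := by
  have h1 := curvature_shift_supp_window r z e he j
  have h2 := hz j
  have h3 := abs_le.1 (show |z j - x j| ≤ (R : ℤ) - 1 by linarith)
  constructor <;> linarith [h1.1, h1.2, h3.1, h3.2]

/-- `dens x` is a cylinder observable on the translated curvature support. [folklore] -/
theorem isCylinder_dens (x : Fin 4 → ℤ) :
    IsCylinder (dens G r x) (r.curvature.supp.image fun e => (e.1 + x, e.2)) :=
  isCylinder_curvature_shift r x

/-- `dens` is bounded, uniformly in the site. [folklore] -/
theorem exists_abs_dens_le : ∃ C : ℝ, 0 ≤ C ∧ ∀ (x : Fin 4 → ℤ) (U : LGConfig 4 G), |dens G r x U| ≤ C :=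
  exists_abs_curvature_le r

/-- **Law of total covariance through one cube.** If for EVERY exterior `η` the cube-kernel
covariance of `dens x`, `dens y` is at least `m`, and the one-point kernels are within `h` of a
common reference value, then on every torus of half-side `L ≥ R + 1` the covariance of
`dens x`, `dens y` is at least `m - 4h²` (`x, y` at sup-distance `≤ R - 1`). [folklore] -/
theorem cov_pair_lower (β : ℝ) (x y : Fin 4 → ℤ) (R L : ℕ) (hRL : R + 1 ≤ L) (hR : 1 ≤ R)
    (hyx : ∀ j, |y j - x j| + 1 ≤ R) {p h m : ℝ}
    (hdx : ∀ η, |kerE G r β (fun j => x j - R) (2 * R + 1) η (dens G r x) - p| ≤ h)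
    (hdy : ∀ η, |kerE G r β (fun j => x j - R) (2 * R + 1) η (dens G r y) - p| ≤ h)
    (hfl : ∀ η, m ≤ kerCov G r β (fun j => x j - R) (2 * R + 1) η (dens G r x) (dens G r y)) :
    m - 4 * h * h ≤ torusE G r β L (fun U => dens G r x U * dens G r y U)
      - torusE G r β L (dens G r x) * torusE G r β L (dens G r y) := by
  haveI := r.secondCountableTopology
  haveI := isProbabilityMeasure_wilsonMeasure (d := 4) (L := 2 * L + 1) r.ρ r.continuous β
  obtain ⟨C, hC0, hC⟩ := exists_abs_dens_le G r
  have hxx : ∀ j, |x j - x j| + 1 ≤ (R : ℤ) := fun j => by simp; exact_mod_cast hR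
  have hcx := continuous_dens r x
  have hcy := continuous_dens r y
  have hcxy : Continuous fun U : LGConfig 4 G => dens G r x U * dens G r y U := hcx.mul hcy
  have hbxy : ∀ U, |dens G r x U * dens G r y U| ≤ C * C := fun U => by
    rw [abs_mul]; exact mul_le_mul (hC x U) (hC y U) (abs_nonneg _) hC0
  -- the three DLR steps
  rw [torusE_eq_torusE_kerE G r β x R L hRL hcx (hC x) (isCylinder_dens G r x)
      (dens_supp_window G r x x R hxx),
    torusE_eq_torusE_kerE G r β x R L hRL hcy (hC y) (isCylinder_dens G r y)
      (dens_supp_window G r x y R hyx),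
    torusE_eq_torusE_kerE G r β x R L hRL hcxy hbxy
      (isCylinder_mul (isCylinder_dens G r x) (isCylinder_dens G r y))
      (fun e he j => by
        rcases Finset.mem_union.1 he with h1 | h2
        · exact dens_supp_window G r x x R hxx e h1 j
        · exact dens_supp_window G r x y R hyx e h2 j)]
  -- law of total covariance on the torus
  unfold torusE
  have hk : ∀ {F : LGConfig 4 G → ℝ}, Continuous F → ∀ {C : ℝ}, (∀ U, |F U| ≤ C) →
      Continuous fun U : GaugeConfig 4 (2 * L + 1) G =>
        kerE G r β (fun j => x j - R) (2 * R + 1) (torusLift (2 * L + 1) U) F := by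
    intro F hF C hC
    unfold kerE
    exact (continuous_integral_ymSpecification r.ρ r.continuous β _ hF hC).comp
      (continuous_torusLift _)
  exact sub_mul_mul_le_cov_of_kernel (μ := wilsonMeasure (d := 4) (L := 2 * L + 1) r.ρ β)
    (hk hcx (hC x)) (hk hcy (hC y)) (hk hcxy hbxy) (fun U => hdx _) (fun U => hdy _)
    (fun U => by have := hfl (torusLift (2 * L + 1) U); unfold kerCov at this; exact this)

/-- **Law of total cumulance through one cube.** If for EVERY exterior `η` the signed cube-kernel
third cumulant `σ · kerK3` of the densities at `x, y, z` is at least `fl`, the three cube-kernel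
covariances are bounded by `c`, and the one-point kernels are within `h₀` of a common value, then on
every torus of half-side `L ≥ R + 1`, `σ · torusK3 ≥ fl - 6 h₀ c - 8 h₀³` (`y, z` at sup-distance
`≤ R - 1` from `x`). [folklore] -/
theorem k3_triple_lower (β : ℝ) (x y z : Fin 4 → ℤ) (R L : ℕ) (hRL : R + 1 ≤ L) (hR : 1 ≤ R)
    (hyx : ∀ j, |y j - x j| + 1 ≤ R) (hzx : ∀ j, |z j - x j| + 1 ≤ R) {p h₀ c fl σ : ℝ}
    (hσ : σ = 1 ∨ σ = -1)
    (hdx : ∀ η, |kerE G r β (fun j => x j - R) (2 * R + 1) η (dens G r x) - p| ≤ h₀)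
    (hdy : ∀ η, |kerE G r β (fun j => x j - R) (2 * R + 1) η (dens G r y) - p| ≤ h₀)
    (hdz : ∀ η, |kerE G r β (fun j => x j - R) (2 * R + 1) η (dens G r z) - p| ≤ h₀)
    (hcyz : ∀ η, |kerCov G r β (fun j => x j - R) (2 * R + 1) η (dens G r y) (dens G r z)| ≤ c)
    (hcxz : ∀ η, |kerCov G r β (fun j => x j - R) (2 * R + 1) η (dens G r x) (dens G r z)| ≤ c)
    (hcxy : ∀ η, |kerCov G r β (fun j => x j - R) (2 * R + 1) η (dens G r x) (dens G r y)| ≤ c)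
    (hfl : ∀ η, fl ≤ σ * kerK3 G r β (fun j => x j - R) (2 * R + 1) η x y z) :
    fl - 6 * h₀ * c - 8 * h₀ ^ 3 ≤ σ * torusK3 G r β L x y z := by
  haveI := r.secondCountableTopology
  haveI := isProbabilityMeasure_wilsonMeasure (d := 4) (L := 2 * L + 1) r.ρ r.continuous β
  obtain ⟨C, hC0, hC⟩ := exists_abs_dens_le G r
  have hxx : ∀ j, |x j - x j| + 1 ≤ (R : ℤ) := fun j => by simp; exact_mod_cast hR
  have hc₁ := continuous_dens r x
  have hc₂ := continuous_dens r y
  have hc₃ := continuous_dens r z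
  have hc₁₂ : Continuous fun U : LGConfig 4 G => dens G r x U * dens G r y U := hc₁.mul hc₂
  have hc₁₃ : Continuous fun U : LGConfig 4 G => dens G r x U * dens G r z U := hc₁.mul hc₃
  have hc₂₃ : Continuous fun U : LGConfig 4 G => dens G r y U * dens G r z U := hc₂.mul hc₃
  have hc₁₂₃ : Continuous fun U : LGConfig 4 G => dens G r x U * dens G r y U * dens G r z U :=
    hc₁₂.mul hc₃
  have hb₂ : ∀ {u v : Fin 4 → ℤ} (U : LGConfig 4 G), |dens G r u U * dens G r v U| ≤ C * C :=
    fun U => by rw [abs_mul]; exact mul_le_mul (hC _ U) (hC _ U) (abs_nonneg _) hC0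
  have hb₃ : ∀ U : LGConfig 4 G, |dens G r x U * dens G r y U * dens G r z U| ≤ C * C * C :=
    fun U => by
      rw [abs_mul]; exact mul_le_mul (hb₂ U) (hC _ U) (abs_nonneg _) (mul_nonneg hC0 hC0)
  have wx := dens_supp_window G r x x R hxx
  have wy := dens_supp_window G r x y R hyx
  have wz := dens_supp_window G r x z R hzx
  have w₂ : ∀ {S S' : Finset (Literature.MathematicalPhysics.QuantumLattice.ZdEdge 4)},
      (∀ e ∈ S, ∀ j, x j - R ≤ e.1 j ∧ e.1 j ≤ x j + R) →
      (∀ e ∈ S', ∀ j, x j - R ≤ e.1 j ∧ e.1 j ≤ x j + R) →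
      ∀ e ∈ S ∪ S', ∀ j, x j - R ≤ e.1 j ∧ e.1 j ≤ x j + R := by
    intro S S' h h' e he j
    rcases Finset.mem_union.1 he with h1 | h2
    · exact h _ h1 j
    · exact h' _ h2 j
  unfold torusK3
  rw [torusE_eq_torusE_kerE G r β x R L hRL hc₁ (hC x) (isCylinder_dens G r x) wx,
    torusE_eq_torusE_kerE G r β x R L hRL hc₂ (hC y) (isCylinder_dens G r y) wy,
    torusE_eq_torusE_kerE G r β x R L hRL hc₃ (hC z) (isCylinder_dens G r z) wz,
    torusE_eq_torusE_kerE G r β x R L hRL hc₁₂ hb₂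
      (isCylinder_mul (isCylinder_dens G r x) (isCylinder_dens G r y)) (w₂ wx wy),
    torusE_eq_torusE_kerE G r β x R L hRL hc₁₃ hb₂
      (isCylinder_mul (isCylinder_dens G r x) (isCylinder_dens G r z)) (w₂ wx wz),
    torusE_eq_torusE_kerE G r β x R L hRL hc₂₃ hb₂
      (isCylinder_mul (isCylinder_dens G r y) (isCylinder_dens G r z)) (w₂ wy wz),
    torusE_eq_torusE_kerE G r β x R L hRL hc₁₂₃ hb₃
      (isCylinder_mul (isCylinder_mul (isCylinder_dens G r x) (isCylinder_dens G r y))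
        (isCylinder_dens G r z)) (w₂ (w₂ wx wy) wz)]
  unfold torusE
  have hk : ∀ {F : LGConfig 4 G → ℝ}, Continuous F → ∀ {C : ℝ}, (∀ U, |F U| ≤ C) →
      Continuous fun U : GaugeConfig 4 (2 * L + 1) G =>
        kerE G r β (fun j => x j - R) (2 * R + 1) (torusLift (2 * L + 1) U) F := by
    intro F hF C hC
    unfold kerE
    exact (continuous_integral_ymSpecification r.ρ r.continuous β _ hF hC).comp
      (continuous_torusLift _)
  exact cumulant3_lower_of_kernel (μ := wilsonMeasure (d := 4) (L := 2 * L + 1) r.ρ β)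
    (hk hc₁ (hC x)) (hk hc₂ (hC y)) (hk hc₃ (hC z)) (hk hc₁₂ hb₂) (hk hc₁₃ hb₂) (hk hc₂₃ hb₂)
    (hk hc₁₂₃ hb₃) hσ (fun U => hdx _) (fun U => hdy _) (fun U => hdz _)
    (fun U => by have := hcyz (torusLift (2 * L + 1) U); unfold kerCov at this; exact this)
    (fun U => by have := hcxz (torusLift (2 * L + 1) U); unfold kerCov at this; exact this)
    (fun U => by have := hcxy (torusLift (2 * L + 1) U); unfold kerCov at this; exact this)
    (fun U => by have := hfl (torusLift (2 * L + 1) U); unfold kerK3 at this; exact this)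

end DLRStep

end Summit.QuantumFields.YangMills.Cruxes.OSLegsFromFemtoAndGap.DlrCollarTransfer.StubLower

end
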